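import Literature.NumberTheory.DiophantineGeometry.CatalanPlusIdeals
import Literature.NumberTheory.DiophantineGeometry.CatalanGaloisPowers
import Literature.NumberTheory.DiophantineGeometry.CatalanPlusAnnihilator
import Literature.NumberTheory.DiophantineGeometry.CatalanTheoremI
import Literature.NumberTheory.DiophantineGeometry.CatalanWittPolynomial
import Literature.NumberTheory.NumberFields.ClassGroupEndomorphism
import HarnessLib

/-!
# The plus argument in `K`-language, II: Mihăilescu's Theorem II from a Thaine-type annihilation statement

This file proves [Schoof2009, Theorem 14.1] — in the unwound form `hA` consumed by the tree's
`Catalan.Plus.mihailescu_of_plus` ("for `p > q ≥ 7`, `p ≢ 1 (mod q)` and a solution of Catalan's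
equation there is a nonzero even `θ = ∑ n_c σ_c ∈ 𝔽_q[G]` with `(x - ζ_p)^θ ∈ K^{*q}`") — **from a
Thaine-type annihilation hypothesis `hT` stated in the language of `K = ℚ(ζ_p)` alone**
(`Catalan.PlusThaine.exists_even_of_thaineK`), and hence Catalan's conjecture from that hypothesis
(`Catalan.PlusThaine.mihailescu_of_thaineK`).  The hypothesis is, for every exponent vector
`f : (ℤ/p)ˣ → ℕ`:

> if every `p`-unit `ε π^m` satisfies `∏_c σ_c(ε π^m)^{f_c} ∈ C · E^q` (explicitly: equals
> `∏_a (ζ^a - 1)^{n_a} · (ε' π^{m'})^q` for some `n : (ℤ/p)ˣ → ℕ` and some `p`-unit), then for every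
> nonzero ideal `I` of `𝓞 K` the ideal `∏_c (σ_c(I) σ_{-c}(I))^{f_c}` is principal times a `q`-th power

— i.e. "the `ℤ[G]`-annihilator of `E/CE^q` annihilates `Cl/Cl^q` after symmetrisation by `1 + ι`",
which is [Schoof2009, Theorem 16.3] (Thaine's theorem) transported from `ℚ(ζ_p)⁺` to `ℚ(ζ_p)`; it is
what the tree's Lemma 16.2 (`NumberFields.exists_prime_classGroup_kummer`) and the Thaine descent of
`CatalanThaineField`/`CatalanThaineClaim` are set up to deliver.

## The argument ([Schoof2009, pp. 92–93], reorganised to avoid completions and the real subfield)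

Let `β = x - ζ`.  Inputs from the tree: `q² ∣ x` (Theorem I / 10.2, `Catalan.sq_dvd_and_isWieferich_of_isPrincipal`),
`(β) = 𝔭 𝔞^q` (`Catalan.span_sub_zeta_pow_eq`), the basis of `E/E^q` (Prop. 13.7, through the coordinate
map `crd` of `CatalanPUnitCoordinates`), the kernel of Prop. 14.2 (`Catalan.not_sq_dvd_zeta_pow_sub_one_sub_pow`),
and Theorem 12.4 in its final form (inside `Catalan.Plus.mihailescu_of_plus`).  In the semisimple ring
`A = 𝔽_q[ℤ/g]` acting on coordinates, let `𝓒 ⊇ 𝓒_P` be the ideals of coordinates of cyclotomic pairs,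
resp. of cyclotomic pairs that are `q`-th powers modulo `q²` (`Sel`); `𝓒_P ≠ 𝓒` by Prop. 14.2
(`ζ^q - 1`), so there is `f₀ ∈ 𝓒 ∖ 0` with `f₀ 𝓒_P = 0` (complements in semisimple rings).  Lift
`f₀` to the even vector `n₁ = f + ι f` and let `Φ(I) = I^{n₁}`; by `hT` (applicable because `f₀ ∈ 𝓒`)
the induced endomorphism `Θ` of `Cl` takes values in `Cl^q`, hence `Θ^{N+1}` kills the `q`-torsion class
`[𝔞]` (`ClassGroup.iterate_apply_eq_one_of_card_le`): `𝔞^{n_N} = (δ)`, so `β^{n_N} = η π^S δ^q` with a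
unit `η`.  Since `β`, hence `β^{n_N}`, is a `q`-th power modulo `q²` and `δ` is prime to `q`, so is
`η π^S`; with `F = (2f₀)^{N+1}` one has `crd((εη π^m)^{n_N}) = F · crd(ε π^m)`, `F crd(η π^S) ∈ 𝓒` is
the coordinate of a cyclotomic pair which is then `Sel`, i.e. in `𝓒_P`, so `F² crd(η π^S) = 0`:
`((η π^S)^{n_N})^{n_N} ∈ E^q`.  Therefore `β^{n_N ⋆ n_N ⋆ n_N}` is a `q`-th power; reducing the (even)
exponent vector modulo `q` gives `θ`, nonzero because `F³ ≠ 0` (`A` is reduced).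

## References

* R. Schoof, *Catalan's Conjecture*, Universitext, Springer 2009, Theorem 14.1 and its proof,
  Proposition 14.2, Theorem 16.3 (book pp. 92–93, 109). [Schoof2009]
* F. Thaine, *On the ideal class groups of real abelian number fields*, Ann. of Math. 128 (1988). [Thaine1988]
-/

namespace Literature.NumberTheory.DiophantineGeometry

namespace Catalan.PlusThaine

open NumberField NumberField.Units Finset IsCyclotomicExtension
open Literature.NumberTheory.NumberFields.Stickelberger Literature.NumberTheory.NumberFields.UnitGalois
open Catalan.PUnits Catalan.Minus Catalan.Coord Catalan.PlusRing Catalan.PlusIdeals Catalan.GalPow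
open Literature.NumberTheory.NumberFields
open scoped Pointwise nonZeroDivisors

set_option backward.isDefEq.respectTransparency false
set_option maxSynthPendingDepth 3

variable {p : ℕ} [hp : Fact p.Prime] {K : Type*} [Field K] [NumberField K]
  [hK : IsCyclotomicExtension {p} ℚ K] {ζ : K} (hζ : IsPrimitiveRoot ζ p)

/-! ### `β = x - ζ` and its conjugates: prime to `q`, `q`-th powers modulo `q²` -/

omit [NumberField K] hK in
/-- `-ζ` is a `q`-th power in `𝓞 K` for `q` prime to `2p` (`-ζ` has order dividing `2p`).
[cite: Schoof2009, Corollary 10.3 (proof: "`-ζ_p` is a `q`th power in `ℚ(ζ_p)`")] -/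
theorem exists_pow_eq_neg_toInteger {q : ℕ} (hq : q.Coprime (2 * p)) :
    ∃ U : 𝓞 K, U ^ q = -hζ.toInteger := by
  have hp1 : 1 < 2 * p := by have := hp.out.one_lt; omega
  -- `q e ≡ 1 (mod 2p)`
  obtain ⟨e, -, he⟩ := Nat.exists_mul_mod_eq_one_of_coprime hq hp1
  refine ⟨(-hζ.toInteger) ^ e, ?_⟩
  have hzp : (-hζ.toInteger) ^ (2 * p) = 1 := by
    rw [neg_pow, pow_mul, neg_one_sq, one_pow, one_mul, pow_mul', hζ.toInteger_isPrimitiveRoot.pow_eq_one,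
      one_pow]
  rw [← pow_mul', ← Nat.mod_add_div (q * e) (2 * p), he, pow_add, pow_one, pow_mul, hzp, one_pow, mul_one]

omit [NumberField K] hK in
/-- **`β = x - ζ` is a `q`-th power modulo `q²` up to `q`-units** when `q² ∣ x`
([Schoof2009, Corollary 10.3]: `x - ζ_p = -ζ_p (1 - ζ_p⁻¹ x)` with `1 - ζ_p⁻¹ x ≡ 1 (mod q²)`).
[cite: Schoof2009, Corollary 10.3] -/
theorem sel_sub_toInteger {q : ℕ} (hq : q.Coprime (2 * p)) {x : ℤ} (hx : (q : ℤ) ^ 2 ∣ x) :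
    ∃ u c : 𝓞 K, IsCoprime c (q : 𝓞 K) ∧ (q : 𝓞 K) ^ 2 ∣ ((x : 𝓞 K) - hζ.toInteger) * c ^ q - u ^ q := by
  obtain ⟨U, hU⟩ := exists_pow_eq_neg_toInteger hζ hq
  refine Sel.of_sq_dvd_sub (z := -hζ.toInteger) ?_ (Sel.of_sq_dvd_sub_pow (U := U) ?_)
  · rw [sub_neg_eq_add, sub_add_cancel]
    have := map_dvd (Int.castRingHom (𝓞 K)) hx
    simpa using this
  · rw [hU, sub_self]; exact dvd_zero _

omit [NumberField K] hK in
/-- **`β = x - ζ` is prime to `q`** when `q ∣ x`: `-ζ^{p-1} β + ζ^{p-1} (x/q) q = 1`. [folklore] -/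
theorem isCoprime_sub_toInteger {q : ℕ} {x : ℤ} (hx : (q : ℤ) ∣ x) :
    IsCoprime ((x : 𝓞 K) - hζ.toInteger) (q : 𝓞 K) := by
  obtain ⟨x', rfl⟩ := hx
  have hzp : hζ.toInteger ^ p = 1 := hζ.toInteger_isPrimitiveRoot.pow_eq_one
  have hp1 : hζ.toInteger ^ (p - 1) * hζ.toInteger = 1 := by
    rw [← pow_succ, Nat.sub_add_cancel hp.out.one_lt.le, hzp]
  refine ⟨-hζ.toInteger ^ (p - 1), hζ.toInteger ^ (p - 1) * (x' : 𝓞 K), ?_⟩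
  push_cast
  linear_combination hp1

/-- Conjugates, products and powers: `Sel(w) ⟹ Sel(∏_c σ_c(w)^{n_c})` on `𝓞 K`.
[cite: Schoof2009, Ch. 10 (p. 67: `S` is an `𝔽_q[G]`-module)] -/
theorem sel_prod_gal_pow {q : ℕ} {w : 𝓞 K}
    (hw : ∃ u c : 𝓞 K, IsCoprime c (q : 𝓞 K) ∧ (q : 𝓞 K) ^ 2 ∣ w * c ^ q - u ^ q)
    (n : (ZMod p)ˣ → ℕ) :
    ∃ u c : 𝓞 K, IsCoprime c (q : 𝓞 K) ∧ (q : 𝓞 K) ^ 2 ∣ (∏ c, (gal p K c • w) ^ n c) * c ^ q - u ^ q :=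
  Sel.prod _ fun c _ => Sel.pow (by
    have := Sel.map (MulSemiringAction.toRingHom _ (𝓞 K) (gal p K c)) hw
    rwa [MulSemiringAction.toRingHom_apply] at this) _

/-- Conjugates, products and powers of an element prime to `q` are prime to `q`. [folklore] -/
theorem isCoprime_prod_gal_pow {q : ℕ} {w : 𝓞 K} (hw : IsCoprime w (q : 𝓞 K)) (n : (ZMod p)ˣ → ℕ) :
    IsCoprime (∏ c, (gal p K c • w) ^ n c) (q : 𝓞 K) := by
  refine IsCoprime.prod_left fun c _ => IsCoprime.pow_left ?_
  have := hw.map (MulSemiringAction.toRingHom _ (𝓞 K) (gal p K c))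
  rwa [MulSemiringAction.toRingHom_apply, map_natCast] at this

/-! ### Group-ring powers of `p`-units as `p`-units -/

/-- **`(ε π^m)^n = ∏_c σ_c(ε π^m)^{n_c}` is the `p`-unit with unit part `∏_c (σ_c(ε) u_c^m)^{n_c}` and
`π`-exponent `(∑ n_c) m`.** [cite: Schoof2009, Ch. 7 (p. 38) and Proposition 13.7 (proof)] -/
theorem prod_gal_punit_pow_eq (ε : (𝓞 K)ˣ) (m : ℤ) (n : (ZMod p)ˣ → ℕ) :
    ∏ c, (gal p K c (punit hζ ε m)) ^ n c =
      punit hζ (∏ c, (unitsGal (gal p K c) ε * uσ hζ c ^ m) ^ n c) (∑ c, (n c : ℤ) * m) :=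
  prod_gal_punit_pow hζ Finset.univ id (fun _ => ε) (fun _ => m) n

/-- `σ_{-c}(ε π^m) = σ_c(σ_{-1}(ε π^m))` at the level of pairs. [folklore] -/
theorem unitsGal_neg (c : (ZMod p)ˣ) (ε : (𝓞 K)ˣ) (m : ℤ) :
    unitsGal (gal p K (-c)) ε * uσ hζ (-c) ^ m =
      unitsGal (gal p K c) (unitsGal (gal p K (-1)) ε * uσ hζ (-1) ^ m) * uσ hζ c ^ m := by
  rw [show -c = c * -1 by rw [mul_neg, mul_one], gal_mul, unitsGal_mul, uσ_mul, map_mul, map_zpow,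
    mul_zpow]
  simp only [mul_comm, mul_left_comm]

/-! ### Small consequences of the coordinate package -/

section Package

variable {g : ℕ} [NeZero g] {q : ℕ} [hq : Fact q.Prime]
variable {γ : (ZMod p)ˣ} {ε₀ : (𝓞 K)ˣ} {k₀ : ℤ} {crd : (𝓞 K)ˣ → ℤ → ZMod g → ZMod q}
variable
  (hrep : ∀ (ε : (𝓞 K)ˣ) (m : ℤ), ∃ (ε' : (𝓞 K)ˣ) (m' : ℤ),
    punit hζ ε m = (∏ k : ZMod g, (gal p K (γ ^ k.val) (punit hζ ε₀ k₀)) ^ (crd ε m k).val) *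
      (punit hζ ε' m') ^ q)
  (huniq : ∀ (ε : (𝓞 K)ˣ) (m : ℤ) (c : ZMod g → ℕ) (ε' : (𝓞 K)ˣ) (m' : ℤ),
    punit hζ ε m = (∏ k : ZMod g, (gal p K (γ ^ k.val) (punit hζ ε₀ k₀)) ^ (c k)) *
      (punit hζ ε' m') ^ q → ∀ k, (c k : ZMod q) = crd ε m k)
variable (toR : (ZMod g → ZMod q) → MonoidAlgebra (ZMod q) (Multiplicative (ZMod g)))
  (htoR : ∀ v x, (toR v).coeff x = v (Multiplicative.toAdd x))

omit [NeZero g] hq in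
/-- `crd` only depends on the `p`-unit `ε π^m` (the pair `(ε, m)` is determined by it,
`Catalan.PUnits.punit_injective`). [folklore] -/
theorem crd_congr {ε ε' : (𝓞 K)ˣ} {m m' : ℤ} (h : punit hζ ε m = punit hζ ε' m') :
    crd ε m = crd ε' m' := by
  obtain ⟨rfl, rfl⟩ := punit_injective hζ h
  rfl

include huniq htoR in
/-- **The coordinate vector of the generator `u = ε₀ π^{k₀}` is `1 ∈ A`.** [cite: Schoof2009, Proposition 13.7] -/
theorem toR_crd_gen : toR (crd ε₀ k₀) = 1 := by
  classical
  have h := crd_prod_gal hζ huniq (fun k : ZMod g => if k = 0 then 1 else 0)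
  have hU : (∏ k : ZMod g, (unitsGal (gal p K (γ ^ k.val)) ε₀ * uσ hζ (γ ^ k.val) ^ k₀) ^
      (if k = 0 then 1 else 0)) = ε₀ := by
    rw [Finset.prod_eq_single (0 : ZMod g) (fun k _ hk => by rw [if_neg hk, pow_zero])
      (fun h => absurd (Finset.mem_univ _) h), if_pos rfl, pow_one, ZMod.val_zero, pow_zero, gal_one,
      unitsGal_one, uσ_one, one_zpow, mul_one]
  have hM : (∑ k : ZMod g, ((if k = 0 then 1 else 0 : ℕ) : ℤ) * k₀) = k₀ := by
    rw [Finset.sum_eq_single (0 : ZMod g) (fun k _ hk => by rw [if_neg hk, Nat.cast_zero, zero_mul])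
      (fun h => absurd (Finset.mem_univ _) h), if_pos rfl, Nat.cast_one, one_mul]
  rw [hU, hM] at h
  apply MonoidAlgebra.coeff_inj.mp
  ext x
  rw [htoR, h (Multiplicative.toAdd x), MonoidAlgebra.one_def, MonoidAlgebra.coeff_single,
    Finsupp.single_apply]
  by_cases hk : x = 1
  · subst hk
    rw [toAdd_one, if_pos rfl, Nat.cast_one, if_pos rfl]
  · have hk' : Multiplicative.toAdd x ≠ 0 := fun h0 => hk (by rw [← ofAdd_toAdd x, h0, ofAdd_zero])
    rw [if_neg hk', Nat.cast_zero, if_neg (Ne.symm hk)]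

end Package

/-! ### The main theorem -/

set_option maxHeartbeats 4000000 in
/-- **Mihăilescu's Theorem II in the form `hA`, from a Thaine-type annihilation hypothesis**
([Schoof2009, Theorem 14.1 with Corollary 10.3]: "for `p > q` odd primes with `p ≢ 1 (mod q)`, `S⁺`
has a nonzero `𝔽_q[G⁺]`-annihilator, and `(x - ζ_p)^{1+ι} ∈ S⁺`", unwound: there is a nonzero even
`n : (ℤ/p)ˣ → ℕ`, `n_c < q`, with `∏_c (x - ζ^c)^{n_c}` a `q`-th power in `K`).  The hypothesis `hT` is
Thaine's theorem [Schoof2009, Theorem 16.3] for `ℚ(ζ_p)` in the language of `K`: for every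
`f : (ℤ/p)ˣ → ℕ` such that `∏_c σ_c(ε π^m)^{f_c} ∈ C E^q` for all `p`-units `ε π^m`, every ideal
`∏_c (σ_c(I) σ_{-c}(I))^{f_c}` is principal times a `q`-th power.  See the module docstring for the proof.
[cite: Schoof2009, Theorem 14.1 (proof, pp. 92–93)] [cite: Schoof2009, Corollary 10.3]
[cite: Schoof2009, Theorem 16.3] -/
theorem exists_even_of_thaineK {q : ℕ} (hq : q.Prime) (hq7 : 7 ≤ q) (hqp : q < p)
    (hmod : ¬ p ≡ 1 [MOD q]) {x y : ℤ} (hx : x ≠ 0) (hy : y ≠ 0) (h : x ^ p - y ^ q = 1)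
    (hT : ∀ f : (ZMod p)ˣ → ℕ,
      (∀ (ε : (𝓞 K)ˣ) (m : ℤ), ∃ (n : (ZMod p)ˣ → ℕ) (ε' : (𝓞 K)ˣ) (m' : ℤ),
        ∏ c : (ZMod p)ˣ, (gal p K c (punit hζ ε m)) ^ f c =
          (∏ a : (ZMod p)ˣ, (ζ ^ (a : ZMod p).val - 1) ^ n a) * punit hζ ε' m' ^ q) →
      ∀ I : Ideal (𝓞 K), I ≠ ⊥ → ∃ (J : Ideal (𝓞 K)) (u v : 𝓞 K), u ≠ 0 ∧ v ≠ 0 ∧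
        Ideal.span {u} * ∏ c : (ZMod p)ˣ, ((gal p K c • I) * (gal p K (-c) • I)) ^ f c =
          Ideal.span {v} * J ^ q) :
    ∃ n : (ZMod p)ˣ → ℕ, (∀ c, n (-c) = n c) ∧ (∀ c, n c < q) ∧ (∃ c, n c ≠ 0) ∧
      ∃ α : K, ∏ c : (ZMod p)ˣ, ((x : K) - ζ ^ (c : ZMod p).val) ^ n c = α ^ q := by
  classical
  -- ### numerics
  have hp2 : p ≠ 2 := by omega
  have hq2 : q ≠ 2 := by omega
  have hpq : p ≠ q := by omega
  have hqp' : q ≠ p := fun h => hpq h.symm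
  have hpo : Odd p := hp.out.odd_of_ne_two hp2
  have hqo : Odd q := hq.odd_of_ne_two hq2
  haveI hqF : Fact q.Prime := ⟨hq⟩
  haveI : NeZero p := ⟨hp.out.ne_zero⟩
  obtain ⟨g, hg⟩ : ∃ g, p - 1 = 2 * g := (hp.out.even_sub_one hp2).two_dvd
  have hg0 : g ≠ 0 := by omega
  haveI : NeZero g := ⟨hg0⟩
  have hqg : ¬ q ∣ g := fun hdiv => hmod (by
    have h1 : q ∣ p - 1 := hdiv.trans ⟨2, by rw [hg, mul_comm]⟩
    exact ((Nat.modEq_iff_dvd' hp.out.one_lt.le).mpr h1).symm)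
  have hqcop : q.Coprime (2 * p) := Nat.Coprime.mul_right
    ((Nat.coprime_primes hq Nat.prime_two).mpr hq2) ((Nat.coprime_primes hq hp.out).mpr hqp')
  -- ### inputs from the tree: `q² ∣ x`, `(β) = 𝔭 𝔞^q`
  have hq2x : (q : ℤ) ^ 2 ∣ x := (sq_dvd_and_isWieferich_of_isPrincipal hpo hq hqo hx hy h
    (fun 𝔩 h1 h2 => isPrincipal_prod_smul_of_absNorm_prime hpo hζ 𝔩 h1 h2)).1
  have hqx : (q : ℤ) ∣ x := (dvd_pow_self (q : ℤ) two_ne_zero).trans hq2x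
  set z : 𝓞 K := hζ.toInteger with hz
  obtain ⟨𝔞f, h𝔞f⟩ := span_sub_zeta_pow_eq hζ hq hpo hqo hx hy h
  obtain ⟨h𝔞1, -⟩ := h𝔞f 1 (Finset.mem_Ico.mpr ⟨le_refl 1, hp.out.one_lt⟩)
  set 𝔞 : Ideal (𝓞 K) := 𝔞f 1 with h𝔞def
  rw [pow_one] at h𝔞1
  set β : 𝓞 K := (x : 𝓞 K) - z with hβ
  have hπp : Prime (z - 1) := prime_zeta_sub_one hζ
  have hπ0 : z - 1 ≠ 0 := hπp.ne_zero
  have hβ0 : β ≠ 0 := by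
    intro h0
    -- `z - 1 ∣ β - (x - 1) = 1 - z`... directly: `ζ = x` would make `ζ - 1 = x - 1` an integer divisible
    -- by the prime `ζ - 1` exactly once — simplest: `σ_2 β = β` forces `ζ^2 = ζ`
    have hzx : z = (x : 𝓞 K) := by rw [hβ, sub_eq_zero] at h0; exact h0.symm
    have h2 : ((2 : ℕ) : ZMod p) ≠ 0 := by
      rw [Ne, ZMod.natCast_eq_zero_iff]
      intro h2; have := Nat.le_of_dvd two_pos h2; omega
    set a2 : (ZMod p)ˣ := ZMod.unitOfCoprime 2 ((Nat.coprime_primes Nat.prime_two hp.out).mpr hp2.symm)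
    have ha2 : (a2 : ZMod p).val = 2 := by
      rw [ZMod.coe_unitOfCoprime, ZMod.val_natCast, Nat.mod_eq_of_lt (by omega)]
    have h3 := gal_smul_toInteger hζ (K := K) a2
    rw [ha2, ← hz, hzx, smul_intCast_ringOfIntegers, ← hzx] at h3
    -- `z = z^2`, so `z = 1`
    have h4 : z * (z - 1) = 0 := by rw [mul_sub, mul_one, ← sq, ← h3, sub_self]
    rcases mul_eq_zero.mp h4 with h5 | h5
    · exact hζ.toInteger_isPrimitiveRoot.ne_zero hp.out.ne_zero h5
    · exact hπ0 h5
  have h𝔞0 : 𝔞 ≠ ⊥ := by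
    intro h0
    rw [h0, ← Ideal.zero_eq_bot, zero_pow hq.ne_zero, mul_zero, Ideal.zero_eq_bot,
      Ideal.span_singleton_eq_bot] at h𝔞1
    exact hβ0 h𝔞1
  -- ### the coordinate package and the ring `A = 𝔽_q[ℤ/g]`
  obtain ⟨γ, ε₀, k₀, crd, hγ, hrep, huniq⟩ := exists_crd hζ hg hp2 hq2 hqp' hqg
  let toR : (ZMod g → ZMod q) → MonoidAlgebra (ZMod q) (Multiplicative (ZMod g)) := fun v =>
    MonoidAlgebra.ofCoeff (Finsupp.equivFunOnFinite.symm fun x => v (Multiplicative.toAdd x))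
  have htoR : ∀ v x, (toR v).coeff x = v (Multiplicative.toAdd x) := fun v x => by
    simp only [toR, Finsupp.coe_equivFunOnFinite_symm]
  haveI := isSemisimpleRing (g := g) (q := q) hqg
  haveI := isReduced (g := g) (q := q) hqg
  -- ### the ideals `𝓒 ⊇ 𝓒_P`
  set SP : Set (MonoidAlgebra (ZMod q) (Multiplicative (ZMod g))) := {Y | ∃ N : (ZMod p)ˣ → ℕ,
      (∃ u c : 𝓞 K, IsCoprime c (q : 𝓞 K) ∧
        (q : 𝓞 K) ^ 2 ∣ (∏ b, (gal p K b • (hζ.toInteger - 1)) ^ N b) * c ^ q - u ^ q) ∧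
      Y = toR (crd (∏ a, uσ hζ a ^ N a) (∑ a, (N a : ℤ)))} with hSP
  set 𝓒 : Ideal (MonoidAlgebra (ZMod q) (Multiplicative (ZMod g))) :=
    Ideal.span (Set.range fun a : (ZMod p)ˣ => toR (crd (uσ hζ a) 1)) with h𝓒
  set 𝓒P : Ideal (MonoidAlgebra (ZMod q) (Multiplicative (ZMod g))) := Ideal.span SP with h𝓒P
  have hcyc_mem : ∀ N : (ZMod p)ˣ → ℕ, toR (crd (∏ a, uσ hζ a ^ N a) (∑ a, (N a : ℤ))) ∈ 𝓒 := by
    intro N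
    have h1 : crd (∏ a, uσ hζ a ^ N a) (∑ a, (N a : ℤ)) = ∑ a, N a • crd (uσ hζ a) 1 := by
      have := crd_prod_pow hζ hrep huniq Finset.univ (fun a => uσ hζ a) (fun _ => (1 : ℤ)) N
      simpa using this
    rw [h1, toR_sum toR htoR]
    refine Ideal.sum_mem _ fun a _ => ?_
    rw [toR_nsmul toR htoR, nsmul_eq_mul]
    exact Ideal.mul_mem_left _ _ (Ideal.subset_span ⟨a, rfl⟩)
  have hle : 𝓒P ≤ 𝓒 := Ideal.span_le.mpr (by rintro _ ⟨N, -, rfl⟩; exact hcyc_mem N)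
  -- `𝓒_P ≠ 𝓒` by [Schoof2009, Proposition 14.2] applied to `ζ^q - 1`
  set qu : (ZMod p)ˣ := ZMod.unitOfCoprime q ((Nat.coprime_primes hq hp.out).mpr hqp') with hqu
  have hqu_val : (qu : ZMod p).val = q := by
    rw [hqu, ZMod.coe_unitOfCoprime, ZMod.val_natCast, Nat.mod_eq_of_lt hqp]
  have hXq : toR (crd (uσ hζ qu) 1) ∈ 𝓒 := Ideal.subset_span ⟨qu, rfl⟩
  have hXq' : toR (crd (uσ hζ qu) 1) ∉ 𝓒P := by
    intro hmem
    obtain ⟨N, hNsel, hNeq⟩ := mem_of_mem_span_sel hζ hrep huniq hg hγ toR htoR hp2 hq2 hqp' hmem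
    have hcrd : crd (uσ hζ qu) 1 = crd (∏ a, uσ hζ a ^ N a) (∑ a, (N a : ℤ)) :=
      toR_injective toR htoR hNeq
    obtain ⟨δ, nδ, hδ⟩ := exists_punit_eq_mul_pow hζ hrep huniq hcrd
    have hsel' : ∃ u c : 𝓞 K, IsCoprime c (q : 𝓞 K) ∧ (q : 𝓞 K) ^ 2 ∣
        ((((∏ a, uσ hζ a ^ N a : (𝓞 K)ˣ)) : 𝓞 K) * (hζ.toInteger - 1) ^ (∑ a, N a)) * c ^ q - u ^ q := by
      rw [cycUnit_mul_pi_pow]; exact hNsel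
    have h1 : punit hζ (uσ hζ qu) ((1 : ℕ) : ℤ) =
        punit hζ (∏ a, uσ hζ a ^ N a) ((∑ a, N a : ℕ) : ℤ) * punit hζ δ nδ ^ q := by
      rw [Nat.cast_one, Nat.cast_sum]; exact hδ
    have hsel := sel_of_punit_eq_mul_pow hζ hq hpq h1 hsel'
    rw [pow_one] at hsel
    have hzq : ((uσ hζ qu : (𝓞 K)ˣ) : 𝓞 K) * (hζ.toInteger - 1) = hζ.toInteger ^ q - 1 := by
      rw [mul_comm, ← gal_smul_pi, smul_sub, smul_one, gal_smul_toInteger hζ, hqu_val]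
    rw [hzq] at hsel
    obtain ⟨U, hU⟩ := Sel.exists_sq_dvd_sub_pow hsel
    exact not_sq_dvd_zeta_pow_sub_one_sub_pow hζ hq hqo hqp U hU
  have hlt : 𝓒P < 𝓒 := lt_of_le_of_ne hle (fun heq => hXq' (heq ▸ hXq))
  obtain ⟨f₀, hf₀C, hf₀0, hf₀kill⟩ := exists_mem_ne_zero_forall_mul_eq_zero hlt
  -- ### exponent vectors: `fvec` (half lift of `f₀`), `n₁ = fvec + ι fvec`, convolution iterates
  set fc : ZMod g → ℕ := fun k => (f₀.coeff (Multiplicative.ofAdd k)).val with hfc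
  set fvec : (ZMod p)ˣ → ℕ := fun c => ∑ k : ZMod g, if c = γ ^ k.val then fc k else 0 with hfvec
  set n₁ : (ZMod p)ˣ → ℕ := fun c => fvec c + fvec (-c) with hn₁
  have hn₁even : ∀ c, n₁ (-c) = n₁ c := fun c => by simp only [hn₁, neg_neg]; ring
  set conv : ((ZMod p)ˣ → ℕ) → ((ZMod p)ˣ → ℕ) → ((ZMod p)ˣ → ℕ) :=
    fun n n' c => ∑ a, n a * n' (a⁻¹ * c) with hconv
  have hconv' : ∀ n n' c, conv n n' c = ∑ a, n a * n' (a⁻¹ * c) := fun _ _ _ => rfl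
  let nSeq : ℕ → ((ZMod p)ˣ → ℕ) := fun j =>
    Nat.rec (motive := fun _ => (ZMod p)ˣ → ℕ) n₁ (fun _ prev => conv n₁ prev) j
  have hnSeq0 : nSeq 0 = n₁ := rfl
  have hnSeqS : ∀ j, nSeq (j + 1) = conv n₁ (nSeq j) := fun j => rfl
  have hnSeq_even : ∀ j c, nSeq j (-c) = nSeq j c := by
    intro j
    induction j with
    | zero => exact hn₁even
    | succ j ih => intro c; rw [hnSeqS]; exact conv_neg conv hconv' _ _ ih c
  -- the power operations on `K`, `𝓞 K` and ideals
  let pw : K → ((ZMod p)ˣ → ℕ) → K := fun Y n => ∏ c, (gal p K c Y) ^ n c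
  have hpw : ∀ Y n, pw Y n = ∏ c, (gal p K c Y) ^ n c := fun _ _ => rfl
  let pwO : 𝓞 K → ((ZMod p)ˣ → ℕ) → 𝓞 K := fun Y n => ∏ c, (gal p K c • Y) ^ n c
  have hpwO : ∀ Y n, pwO Y n = ∏ c, (gal p K c • Y) ^ n c := fun _ _ => rfl
  let ipw : Ideal (𝓞 K) → ((ZMod p)ˣ → ℕ) → Ideal (𝓞 K) := fun I n => ∏ c, (gal p K c • I) ^ n c
  have hipw : ∀ I n, ipw I n = ∏ c, (gal p K c • I) ^ n c := fun _ _ => rfl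
  -- ### group-ring powers of `p`-units: pairs and coordinates
  have hpw_pair : ∀ (ε : (𝓞 K)ˣ) (m : ℤ) (n : (ZMod p)ˣ → ℕ), pw (punit hζ ε m) n =
      punit hζ (∏ c, (unitsGal (gal p K c) ε * uσ hζ c ^ m) ^ n c) (∑ c, (n c : ℤ) * m) :=
    fun ε m n => prod_gal_punit_pow_eq hζ ε m n
  have hcrd_fvec : ∀ (ε : (𝓞 K)ˣ) (m : ℤ),
      toR (crd (∏ c, (unitsGal (gal p K c) ε * uσ hζ c ^ m) ^ fvec c) (∑ c, (fvec c : ℤ) * m)) =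
        f₀ * toR (crd ε m) := by
    intro ε m
    rw [mul_toR_crd hζ hrep huniq hg hγ toR htoR hp2 hq2 hqp' f₀ ε m, crd_prod_pow hζ hrep huniq,
      crd_prod_pow hζ hrep huniq]
    congr 1
    simp only [hfvec, Finset.sum_smul, ite_smul, zero_smul]
    rw [Finset.sum_comm]
    refine Finset.sum_congr rfl fun k _ => ?_
    rw [Finset.sum_ite_eq' Finset.univ (γ ^ k.val), if_pos (Finset.mem_univ _)]
  have hcrd_fvec_neg : ∀ (ε : (𝓞 K)ˣ) (m : ℤ),
      toR (crd (∏ c, (unitsGal (gal p K c) ε * uσ hζ c ^ m) ^ fvec (-c)) (∑ c, (fvec (-c) : ℤ) * m)) =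
        f₀ * toR (crd ε m) := by
    intro ε m
    have e1 : (∏ c, (unitsGal (gal p K c) ε * uσ hζ c ^ m) ^ fvec (-c)) =
        ∏ c, (unitsGal (gal p K c) (unitsGal (gal p K (-1)) ε * uσ hζ (-1) ^ m) * uσ hζ c ^ m) ^ fvec c := by
      refine Fintype.prod_equiv (Equiv.neg (ZMod p)ˣ) _ _ fun c => ?_
      rw [Equiv.neg_apply, ← unitsGal_neg hζ (-c) ε m, neg_neg]
    have e2 : ∑ c, (fvec (-c) : ℤ) * m = ∑ c, (fvec c : ℤ) * m :=
      Fintype.sum_equiv (Equiv.neg (ZMod p)ˣ) _ _ fun c => by rw [Equiv.neg_apply]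
    rw [e1, e2, hcrd_fvec, crd_gal_neg_one hζ hrep huniq hg hγ hp2 hq2 hqp']
  have hcrd_n₁ : ∀ (ε : (𝓞 K)ˣ) (m : ℤ),
      toR (crd (∏ c, (unitsGal (gal p K c) ε * uσ hζ c ^ m) ^ n₁ c) (∑ c, (n₁ c : ℤ) * m)) =
        (2 * f₀) * toR (crd ε m) := by
    intro ε m
    have e1 : (∏ c, (unitsGal (gal p K c) ε * uσ hζ c ^ m) ^ n₁ c) =
        (∏ c, (unitsGal (gal p K c) ε * uσ hζ c ^ m) ^ fvec c) *
          ∏ c, (unitsGal (gal p K c) ε * uσ hζ c ^ m) ^ fvec (-c) := by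
      rw [← Finset.prod_mul_distrib]
      exact Finset.prod_congr rfl fun c _ => pow_add _ _ _
    have e2 : ∑ c, (n₁ c : ℤ) * m = (∑ c, (fvec c : ℤ) * m) + ∑ c, (fvec (-c) : ℤ) * m := by
      rw [← Finset.sum_add_distrib]
      refine Finset.sum_congr rfl fun c _ => ?_
      simp only [hn₁]; push_cast; ring
    rw [e1, e2, crd_mul hζ hrep huniq, toR_add toR htoR, hcrd_fvec, hcrd_fvec_neg, two_mul, add_mul]
  -- the iterates: `crd ((ε π^m)^{nSeq j}) = (2 f₀)^{j+1} crd (ε π^m)`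
  have hcrd_seq : ∀ (j : ℕ) (ε : (𝓞 K)ˣ) (m : ℤ),
      toR (crd (∏ c, (unitsGal (gal p K c) ε * uσ hζ c ^ m) ^ nSeq j c) (∑ c, (nSeq j c : ℤ) * m)) =
        (2 * f₀) ^ (j + 1) * toR (crd ε m) := by
    intro j
    induction j with
    | zero => intro ε m; rw [zero_add, pow_one]; exact hcrd_n₁ ε m
    | succ j ih =>
      intro ε m
      -- `(ε π^m)^{nSeq (j+1)} = ((ε π^m)^{nSeq j})^{n₁}` as `p`-units
      have e1 : punit hζ (∏ c, (unitsGal (gal p K c) ε * uσ hζ c ^ m) ^ nSeq (j + 1) c)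
          (∑ c, (nSeq (j + 1) c : ℤ) * m) =
          punit hζ (∏ c, (unitsGal (gal p K c)
              (∏ c, (unitsGal (gal p K c) ε * uσ hζ c ^ m) ^ nSeq j c) *
              uσ hζ c ^ (∑ c, (nSeq j c : ℤ) * m)) ^ n₁ c)
            (∑ c, (n₁ c : ℤ) * ∑ c, (nSeq j c : ℤ) * m) := by
        rw [← hpw_pair, ← hpw_pair, ← hpw_pair, hnSeqS, ← pw_pw pw hpw conv hconv']
      rw [crd_congr (crd := crd) hζ e1, hcrd_n₁, ih, pow_succ]
      ring
  -- ### Theorem 16.3 (hypothesis `hT`) gives `Θ : Cl → Cl^q` with `Θ[I] = [I^{n₁}]`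
  have hΦform : ∀ I : Ideal (𝓞 K), ipw I n₁ = ∏ c, ((gal p K c • I) * (gal p K (-c) • I)) ^ fvec c := by
    intro I
    rw [hipw]
    simp only [hn₁, pow_add, mul_pow, Finset.prod_mul_distrib]
    congr 1
    exact Fintype.prod_equiv (Equiv.neg (ZMod p)ˣ) _ _ fun c => by rw [Equiv.neg_apply, neg_neg]
  have hThyp : ∀ (ε : (𝓞 K)ˣ) (m : ℤ), ∃ (n : (ZMod p)ˣ → ℕ) (ε' : (𝓞 K)ˣ) (m' : ℤ),
      ∏ c : (ZMod p)ˣ, (gal p K c (punit hζ ε m)) ^ fvec c =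
        (∏ a : (ZMod p)ˣ, (ζ ^ (a : ZMod p).val - 1) ^ n a) * punit hζ ε' m' ^ q := by
    intro ε m
    have hmem : toR (crd (∏ c, (unitsGal (gal p K c) ε * uσ hζ c ^ m) ^ fvec c)
        (∑ c, (fvec c : ℤ) * m)) ∈ 𝓒 := by
      rw [hcrd_fvec]; exact Ideal.mul_mem_right _ _ hf₀C
    obtain ⟨Nc, hNc⟩ := exists_cyc_of_mem_span hζ hrep huniq hg hγ toR htoR hp2 hq2 hqp' hmem
    obtain ⟨δ, nδ, hδ⟩ := exists_punit_eq_mul_pow hζ hrep huniq (toR_injective toR htoR hNc)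
    refine ⟨Nc, δ, nδ, ?_⟩
    rw [← punit_cycUnit hζ Nc, ← hδ, ← hpw_pair]
  obtain ⟨Θ, hΘ⟩ := ClassGroup.exists_monoidHom_mk0_eq (fun I => ipw I n₁)
    (fun I J => ipw_mul ipw hipw I J n₁) (fun I hI => ipw_ne_bot ipw hipw hI n₁)
    (fun w hw => ⟨pwO w n₁, pwO_ne_zero pwO hpwO hw n₁, ipw_span_singleton pwO hpwO ipw hipw w n₁⟩)
  have hΘq : ∀ yc : ClassGroup (𝓞 K), ∃ zc, Θ yc = zc ^ q := by
    intro yc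
    obtain ⟨⟨I, hI⟩, rfl⟩ := ClassGroup.mk0_surjective yc
    have hI0 : I ≠ ⊥ := mem_nonZeroDivisors_iff_ne_zero.mp hI
    obtain ⟨J, u, v, hu, hv, hJ⟩ := hT fvec hThyp I hI0
    rw [← hΦform] at hJ
    have hJ0 : J ≠ ⊥ := by
      rintro rfl
      rw [← Ideal.zero_eq_bot, zero_pow hq.ne_zero, mul_zero, mul_eq_zero] at hJ
      rcases hJ with hJ | hJ
      · exact hu (Ideal.span_singleton_eq_bot.mp hJ)
      · exact ipw_ne_bot ipw hipw hI0 n₁ hJ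
    refine ⟨ClassGroup.mk0 ⟨J, mem_nonZeroDivisors_iff_ne_zero.mpr hJ0⟩, ?_⟩
    rw [hΘ I hI0, ← map_pow]
    exact ClassGroup.mk0_eq_mk0_iff.mpr ⟨u, v, hu, hv, by simpa using hJ⟩
  -- `[𝔞]` is `q`-torsion
  have h𝔞mem : 𝔞 ∈ (Ideal (𝓞 K))⁰ := mem_nonZeroDivisors_iff_ne_zero.mpr h𝔞0
  have hx₀q : ClassGroup.mk0 ⟨𝔞, h𝔞mem⟩ ^ q = 1 := by
    rw [← map_pow]
    have : ClassGroup.mk0 (⟨𝔞, h𝔞mem⟩ ^ q) = ClassGroup.mk0 1 :=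
      ClassGroup.mk0_eq_mk0_iff.mpr ⟨z - 1, β, hπ0, hβ0, by
        simp only [SubmonoidClass.coe_pow, OneMemClass.coe_one, mul_one]
        exact h𝔞1.symm⟩
    rw [this, map_one]
  set Ncl := Nat.card (ClassGroup (𝓞 K)) with hNcl
  have hiter := ClassGroup.iterate_apply_eq_one_of_card_le Θ hq hΘq hx₀q (N := Ncl + 1) (Nat.le_succ _)
  -- iterates of `Φ` are the powers `nSeq`
  have hΦiter_ne : ∀ (j : ℕ) (I : Ideal (𝓞 K)), I ≠ ⊥ → (fun I => ipw I n₁)^[j] I ≠ ⊥ := by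
    intro j
    induction j with
    | zero => intro I hI; exact hI
    | succ j ih => intro I hI; rw [Function.iterate_succ_apply']; exact ipw_ne_bot ipw hipw (ih I hI) n₁
  have hΦiter : ∀ j, (fun I => ipw I n₁)^[j + 1] 𝔞 = ipw 𝔞 (nSeq j) := by
    intro j
    induction j with
    | zero => rfl
    | succ j ih => rw [Function.iterate_succ_apply', ih, hnSeqS, ipw_ipw ipw hipw conv hconv']
  have hΘiter : ∀ (j : ℕ) (I : Ideal (𝓞 K)) (hI : I ≠ ⊥),
      (Θ^[j]) (ClassGroup.mk0 ⟨I, mem_nonZeroDivisors_iff_ne_zero.mpr hI⟩) =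
        ClassGroup.mk0 ⟨(fun I => ipw I n₁)^[j] I,
          mem_nonZeroDivisors_iff_ne_zero.mpr (hΦiter_ne j I hI)⟩ := by
    intro j
    induction j with
    | zero => intro I hI; rfl
    | succ j ih =>
      intro I hI
      rw [Function.iterate_succ_apply', ih I hI, hΘ _ (hΦiter_ne j I hI)]
      congr 1
      exact Subtype.ext (Function.iterate_succ_apply' (fun I => ipw I n₁) j I).symm
  have hprin : (ipw 𝔞 (nSeq Ncl)).IsPrincipal := by
    have h1 := hΘiter (Ncl + 1) 𝔞 h𝔞0
    rw [hiter] at h1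
    have h2 : ClassGroup.mk0 ⟨ipw 𝔞 (nSeq Ncl),
        mem_nonZeroDivisors_iff_ne_zero.mpr (ipw_ne_bot ipw hipw h𝔞0 _)⟩ = 1 := by
      rw [h1]
      congr 1
      apply Subtype.ext
      exact (hΦiter Ncl).symm
    exact (ClassGroup.mk0_eq_one_iff _).mp h2
  set nN := nSeq Ncl with hnN
  obtain ⟨δ, hδ⟩ := hprin.principal
  change ipw 𝔞 nN = Ideal.span {δ} at hδ
  have hδ0 : δ ≠ 0 := by
    rintro rfl
    exact ipw_ne_bot ipw hipw h𝔞0 nN (by rw [hδ, Ideal.span_singleton_eq_bot])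
  -- ### `β^{n_N} = η π^S δ^q`
  set S : ℕ := ∑ c, nN c with hS
  have hspan : Ideal.span {pwO β nN} = Ideal.span {(z - 1) ^ S * δ ^ q} := by
    rw [← ipw_span_singleton pwO hpwO ipw hipw β nN, h𝔞1, ipw_mul ipw hipw, ipw_pow ipw hipw,
      ipw_span_zeta_sub_one ipw hipw hζ, hδ, Ideal.span_singleton_pow, Ideal.span_singleton_pow,
      Ideal.span_singleton_mul_span_singleton]
  obtain ⟨ηu, hη⟩ := Ideal.span_singleton_eq_span_singleton.mp hspan
  set η : (𝓞 K)ˣ := ηu⁻¹ with hηdef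
  have hβpow : pwO β nN = (((η : (𝓞 K)ˣ) : 𝓞 K) * (z - 1) ^ S) * δ ^ q := by
    rw [hηdef, mul_assoc, ← hη, mul_comm (pwO β nN), ← mul_assoc, Units.inv_mul, one_mul]
  -- ### `Sel`: `β`, `β^{n_N}`, hence `η π^S`
  have hselβ := sel_sub_toInteger hζ hqcop hq2x
  have hcopβ := isCoprime_sub_toInteger hζ (K := K) hqx
  have hselβN : ∃ u c : 𝓞 K, IsCoprime c (q : 𝓞 K) ∧ (q : 𝓞 K) ^ 2 ∣ pwO β nN * c ^ q - u ^ q := by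
    rw [hpwO]; exact sel_prod_gal_pow hselβ nN
  have hcopβN : IsCoprime (pwO β nN) (q : 𝓞 K) := by
    rw [hpwO]; exact isCoprime_prod_gal_pow hcopβ nN
  have hcopδ : IsCoprime δ (q : 𝓞 K) := by
    have h1 : IsCoprime (δ ^ q) (q : 𝓞 K) :=
      hcopβN.of_isCoprime_of_dvd_left ⟨((η : (𝓞 K)ˣ) : 𝓞 K) * (z - 1) ^ S, by rw [hβpow, mul_comm]⟩
    exact (IsCoprime.pow_left_iff hq.pos).mp h1
  have hselw₁ : ∃ u c : 𝓞 K, IsCoprime c (q : 𝓞 K) ∧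
      (q : 𝓞 K) ^ 2 ∣ (((η : (𝓞 K)ˣ) : 𝓞 K) * (z - 1) ^ S) * c ^ q - u ^ q :=
    Sel.of_mul_pow hcopδ (by rw [← hβpow]; exact hselβN)
  -- ### the ring side: `F = (2 f₀)^{N+1}`, `F crd(η π^S) ∈ 𝓒_P`, `F² crd(η π^S) = 0`
  set F := (2 * f₀) ^ (Ncl + 1) with hF
  have hF𝓒 : F ∈ 𝓒 := by
    rw [hF, pow_succ]; exact Ideal.mul_mem_left _ _ (Ideal.mul_mem_left _ _ hf₀C)
  have hFkill : ∀ X ∈ SP, F * X = 0 := fun X hX => by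
    have h0 := hf₀kill X (Ideal.subset_span hX)
    rw [hF, pow_succ, mul_assoc, mul_assoc, h0, mul_zero, mul_zero]
  have hF0 : F ^ 3 ≠ 0 := by
    rw [hF, ← pow_mul]
    refine pow_ne_zero _ (fun h0 => hf₀0 ?_)
    have h2 : ((2 : ℕ) : ZMod q) ≠ 0 := by
      rw [Ne, ZMod.natCast_eq_zero_iff]
      intro h2; have := Nat.le_of_dvd two_pos h2; omega
    have h3 : (2 : MonoidAlgebra (ZMod q) (Multiplicative (ZMod g))) * f₀ = ((2 : ℕ) : ZMod q) • f₀ := by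
      rw [Algebra.smul_def, map_natCast, Nat.cast_ofNat]
    rw [h3] at h0
    have := congrArg (fun w => (((2 : ℕ) : ZMod q))⁻¹ • w) h0
    rwa [smul_zero, smul_smul, inv_mul_cancel₀ h2, one_smul] at this
  -- the pair of `(η π^S)^{n_N}` and its coordinates
  have key1 := hcrd_seq Ncl η (S : ℤ)
  have hmem2 : F * toR (crd η (S : ℤ)) ∈ 𝓒 := Ideal.mul_mem_right _ _ hF𝓒
  obtain ⟨Nc, hNc⟩ := exists_cyc_of_mem_span hζ hrep huniq hg hγ toR htoR hp2 hq2 hqp' hmem2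
  have hcrd2 : crd (∏ a, uσ hζ a ^ Nc a) (∑ a, (Nc a : ℤ)) =
      crd (∏ c, (unitsGal (gal p K c) η * uσ hζ c ^ (S : ℤ)) ^ nN c) (∑ c, (nN c : ℤ) * S) :=
    toR_injective toR htoR (hNc.symm.trans key1.symm)
  obtain ⟨δ₂, n₂, hδ₂⟩ := exists_punit_eq_mul_pow hζ hrep huniq hcrd2
  have hsum : ∑ c, (nN c : ℤ) * S = ((S * S : ℕ) : ℤ) := by
    rw [← Finset.sum_mul, ← Nat.cast_sum, ← hS, Nat.cast_mul]
  have hUelt : (((∏ c, (unitsGal (gal p K c) η * uσ hζ c ^ (S : ℤ)) ^ nN c : (𝓞 K)ˣ)) : 𝓞 K) *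
      (z - 1) ^ (S * S) = pwO (((η : (𝓞 K)ˣ) : 𝓞 K) * (z - 1) ^ S) nN := by
    apply FaithfulSMul.algebraMap_injective (𝓞 K) K
    have e1 := coe_unit_mul_pi_pow hζ ((∏ c, (unitsGal (gal p K c) η * uσ hζ c ^ (S : ℤ)) ^ nN c)) (S * S)
    have e2 := coe_unit_mul_pi_pow hζ η S
    have e3 := coe_pwO pw hpw pwO hpwO (((η : (𝓞 K)ˣ) : 𝓞 K) * (z - 1) ^ S) nN
    rw [← hsum, ← hpw_pair, ← e2] at e1
    exact e1.trans e3.symm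
  have hselU : ∃ u c : 𝓞 K, IsCoprime c (q : 𝓞 K) ∧ (q : 𝓞 K) ^ 2 ∣
      ((((∏ c, (unitsGal (gal p K c) η * uσ hζ c ^ (S : ℤ)) ^ nN c : (𝓞 K)ˣ)) : 𝓞 K) *
        (z - 1) ^ (S * S)) * c ^ q - u ^ q := by
    rw [hUelt, hpwO]; exact sel_prod_gal_pow hselw₁ nN
  have hselcyc : ∃ u c : 𝓞 K, IsCoprime c (q : 𝓞 K) ∧
      (q : 𝓞 K) ^ 2 ∣ (∏ b, (gal p K b • (hζ.toInteger - 1)) ^ Nc b) * c ^ q - u ^ q := by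
    have h1 : punit hζ (∏ a, uσ hζ a ^ Nc a) ((∑ a, Nc a : ℕ) : ℤ) =
        punit hζ ((∏ c, (unitsGal (gal p K c) η * uσ hζ c ^ (S : ℤ)) ^ nN c)) ((S * S : ℕ) : ℤ) *
          punit hζ δ₂ n₂ ^ q := by
      rw [Nat.cast_sum, ← hsum]; exact hδ₂
    have := sel_of_punit_eq_mul_pow hζ hq hpq h1 hselU
    rwa [cycUnit_mul_pi_pow] at this
  have hFF : F * (F * toR (crd η (S : ℤ))) = 0 := by
    rw [hNc]; exact hFkill _ ⟨Nc, hselcyc, rfl⟩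
  -- the double power `((η π^S)^{n_N})^{n_N}` is the `q`-th power of a `p`-unit
  have key2 := hcrd_seq Ncl ((∏ c, (unitsGal (gal p K c) η * uσ hζ c ^ (S : ℤ)) ^ nN c))
    (∑ c, (nN c : ℤ) * S)
  rw [key1, hFF, toR_eq_zero_iff toR htoR] at key2
  obtain ⟨ε₂, m₂, hε₂⟩ := exists_eq_pow_of_crd_eq_zero hζ hrep key2
  -- ### the final computation in `K`
  have hβK : pw (β : K) nN = punit hζ η (S : ℤ) * ((δ : 𝓞 K) : K) ^ q := by
    rw [← coe_pwO pw hpw pwO hpwO, hβpow, ← coe_unit_mul_pi_pow hζ η S]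
    push_cast
    ring
  have hW : pw (pw (punit hζ η (S : ℤ)) nN) nN = punit hζ ε₂ m₂ ^ q := by
    rw [hpw_pair, hpw_pair, hε₂]
  have hfin : pw (pw (pw (β : K) nN) nN) nN =
      (punit hζ ε₂ m₂ * pw (pw (((δ : 𝓞 K) : K)) nN) nN) ^ q := by
    rw [hβK, pw_mul pw hpw, pw_pow pw hpw, pw_mul pw hpw, pw_pow pw hpw, hW, mul_pow]
  rw [pw_pw pw hpw conv hconv' (pw (β : K) nN) nN nN, pw_pw pw hpw conv hconv' (β : K) (conv nN nN) nN]
    at hfin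
  set nFin := conv (conv nN nN) nN with hnFin
  have hnNeven : ∀ c, nN (-c) = nN c := hnSeq_even Ncl
  have hnFin_even : ∀ c, nFin (-c) = nFin c := fun c => conv_neg conv hconv' _ _ hnNeven c
  set n' : (ZMod p)ˣ → ℕ := fun c => nFin c % q with hn'
  set d : (ZMod p)ˣ → ℕ := fun c => nFin c / q with hd
  have hsplit : pw (β : K) nFin = pw (β : K) n' * pw (β : K) d ^ q :=
    pw_eq_mul_pow pw hpw (β : K) fun c => (Nat.mod_add_div _ _).symm
  have hβK0 : ((β : 𝓞 K) : K) ≠ 0 := by exact_mod_cast hβ0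
  have hd0 : pw (β : K) d ≠ 0 := pw_ne_zero pw hpw hβK0 d
  -- nonvanishing: otherwise `F³ · 1 = 0`
  have hne : ∃ c, n' c ≠ 0 := by
    by_contra hall
    push Not at hall
    have hdvd : ∀ c, nFin c = 0 + q * d c := fun c => by
      have := Nat.mod_add_div (nFin c) q
      have h0 : nFin c % q = 0 := hall c
      show nFin c = 0 + q * (nFin c / q)
      omega
    -- the three pairs `u^{n_N}`, `(u^{n_N})^{n_N}`, `((u^{n_N})^{n_N})^{n_N}` and their coordinates
    set U1 : (𝓞 K)ˣ := ∏ c, (unitsGal (gal p K c) ε₀ * uσ hζ c ^ k₀) ^ nN c with hU1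
    set M1 : ℤ := ∑ c, (nN c : ℤ) * k₀ with hM1
    set U2 : (𝓞 K)ˣ := ∏ c, (unitsGal (gal p K c) U1 * uσ hζ c ^ M1) ^ nN c with hU2
    set M2 : ℤ := ∑ c, (nN c : ℤ) * M1 with hM2
    set U3 : (𝓞 K)ˣ := ∏ c, (unitsGal (gal p K c) U2 * uσ hζ c ^ M2) ^ nN c with hU3
    set M3 : ℤ := ∑ c, (nN c : ℤ) * M2 with hM3
    have key3 : toR (crd U1 M1) = F := by
      have := hcrd_seq Ncl ε₀ k₀
      rwa [toR_crd_gen hζ huniq toR htoR, mul_one] at this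
    have key4 : toR (crd U2 M2) = F * F := by
      have := hcrd_seq Ncl U1 M1
      rwa [key3] at this
    have key5 : toR (crd U3 M3) = F * (F * F) := by
      have := hcrd_seq Ncl U2 M2
      rwa [key4] at this
    -- `u^{nFin}` is this triple power, and it is the `q`-th power of a `p`-unit
    have hu_pair : pw (punit hζ ε₀ k₀) nFin = punit hζ U3 M3 := by
      rw [hnFin, ← pw_pw pw hpw conv hconv' (punit hζ ε₀ k₀) (conv nN nN) nN,
        ← pw_pw pw hpw conv hconv' (pw (punit hζ ε₀ k₀) nN) nN nN, hpw_pair, hpw_pair, hpw_pair]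
    have hu_pow : pw (punit hζ ε₀ k₀) nFin =
        punit hζ (∏ c, (unitsGal (gal p K c) ε₀ * uσ hζ c ^ k₀) ^ d c) (∑ c, (d c : ℤ) * k₀) ^ q := by
      rw [pw_eq_mul_pow pw hpw (punit hζ ε₀ k₀) (n' := fun _ => 0) hdvd, pw_zero pw hpw, one_mul,
        hpw_pair]
    have hcrd0 := crd_eq_zero_of_eq_pow hζ huniq (hu_pair.symm.trans hu_pow)
    rw [hcrd0, toR_zero toR htoR] at key5
    apply hF0
    rw [pow_succ, pow_two, mul_assoc]
    exact key5.symm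
  -- ### assemble
  refine ⟨n', fun c => by rw [hn']; simp only [hnFin_even], fun c => Nat.mod_lt _ hq.pos, hne,
    (punit hζ ε₂ m₂ * pw (pw ((δ : 𝓞 K) : K) nN) nN) / pw (β : K) d, ?_⟩
  have hprod : ∏ c : (ZMod p)ˣ, ((x : K) - ζ ^ (c : ZMod p).val) ^ n' c = pw (β : K) n' := by
    rw [hpw]
    have hβK : ((β : 𝓞 K) : K) = (x : K) - ζ := by
      rw [hβ, hz, RingOfIntegers.coe_eq_algebraMap, map_sub, map_intCast]
      rfl
    refine Finset.prod_congr rfl fun c _ => ?_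
    rw [hβK, map_sub, map_intCast, gal_apply_zeta hζ c]
  rw [hprod, div_pow, ← hfin, hsplit, mul_div_assoc, ← div_pow, div_self hd0, one_pow, mul_one]

/-- **Catalan's conjecture, modulo Thaine's theorem for `ℚ(ζ_p)` in `K`-language.**  If for all odd
primes `7 ≤ q < p` with `p ≢ 1 (mod q)` the `q`-th power descent statement `hT` of
[Schoof2009, Theorem 16.3] holds for `ℚ(ζ_p)` (hypothesis of `exists_even_of_thaineK`), then every
solution of `x^a - y^b = 1` in integers `x, y > 0`, `a, b ≥ 2` is `3² - 2³ = 1`: the remaining case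
`7 ≤ q < p`, `p ≢ 1 (mod q)` of Mihăilescu's theorem is [Schoof2009, Theorem 14.1] via
`exists_even_of_thaineK` and `Catalan.Plus.mihailescu_of_plus`.
[cite: Mihailescu2004, Theorem 1] [cite: Schoof2009, Theorem 14.1, Theorem 16.3] -/
theorem mihailescu_of_thaineK
    (hT : ∀ (p q : ℕ) [Fact p.Prime], q.Prime → 7 ≤ q → q < p → ¬ p ≡ 1 [MOD q] →
      ∀ (K : Type) [Field K] [NumberField K] [IsCyclotomicExtension {p} ℚ K] (ζ : K)
        (hζ : IsPrimitiveRoot ζ p) (f : (ZMod p)ˣ → ℕ),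
        (∀ (ε : (𝓞 K)ˣ) (m : ℤ), ∃ (n : (ZMod p)ˣ → ℕ) (ε' : (𝓞 K)ˣ) (m' : ℤ),
          ∏ c : (ZMod p)ˣ, (gal p K c (punit hζ ε m)) ^ f c =
            (∏ a : (ZMod p)ˣ, (ζ ^ (a : ZMod p).val - 1) ^ n a) * punit hζ ε' m' ^ q) →
        ∀ I : Ideal (𝓞 K), I ≠ ⊥ → ∃ (J : Ideal (𝓞 K)) (u v : 𝓞 K), u ≠ 0 ∧ v ≠ 0 ∧
          Ideal.span {u} * ∏ c : (ZMod p)ˣ, ((gal p K c • I) * (gal p K (-c) • I)) ^ f c =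
            Ideal.span {v} * J ^ q) :
    mihailescu :=
  Catalan.Plus.mihailescu_of_plus fun p q _ hq hq7 hqp hmod _ _ hx hy h K _ _ _ _ hζ =>
    exists_even_of_thaineK hζ hq hq7 hqp hmod hx hy h (hT p q hq hq7 hqp hmod K _ hζ)

end Catalan.PlusThaine

end Literature.NumberTheory.DiophantineGeometry
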